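import Literature.Computability.AlgebraicComplexity.HI16SkewCircuitsProofs
import Literature.Computability.AlgebraicComplexity.BLMW11KroneckerApproximation
import Literature.Computability.AlgebraicComplexity.BLMW11WeaklySkewDegree
import HarnessLib

/-!
# `(det_n) ∈ VP_ws` and the universality of the determinant for skew circuits
# (Bürgisser–Landsberg–Manivel–Weyman 2011, §9.1–§9.2; Malod–Portier 2008, Prop. 5, Lemma 6)

Two PROVED consequences of the engines of `HI16SkewCircuitsProofs.lean` (cell val-lit, t14), over
every commutative ring `k`:

* `exists_wsCircuit_detPoly` / `exists_wsCircuit_detPoly_wellFormed` — towards **BLMW 2011,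
  §9.1 (i)** ("Since `L_ws(det_n) = O(n⁵)` [Berkowitz], we have `(det_n) ∈ VP_ws`"; Malod–Portier
  2008, Prop. 5: "(DET_n) can be computed by a sequence of weakly skew circuits of polynomial size.
  Proof. We recall here Berkowitz's algorithm …"): a (well-formed) fan-in-two constant-free circuit
  for `det_n` of size `≤ (n+2)(4n³+7)²` over every commutative ring that is skew AND weakly skew in
  the sense of `ArithCircuit.IsWeaklySkew` — the circuit of `HI16Skew.exists_skewCircuit_detPoly`
  (the tree's Mahajan–Vinay/Berkowitz branching program `GKKP2011.bigN`, unrolled) has in every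
  product gate an INPUT operand (`HI16Skew.abpCircuit_hasInputFactor`,
  `HI16Skew.isWeaklySkew_of_hasInputFactor`); `ArithCircuit.trimJunk` makes it well formed. The
  printed `O(n⁵)` is replaced by our `O(n⁷)`. Class-level corollaries for the CORRECTED
  (well-formed, erratum A14 of the val-lit cell) notions of `BLMW11KroneckerApproximation.lean`:
  `wsComplexity_detPoly_le` (`L_ws(det_n) ≤ (n+2)(4n³+7)²`), `isVPwsFamily_detPoly`
  (`(det_n) ∈ VP_ws` = conjunct (i) of the named fact `BLMW2011_sec9_detVPws`),
  `skewComplexity_attained`, and — from conjunct (iii) "weakly skew ⇒ skew, linear factor" —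
  conjunct (ii) (`isPProjection_detPoly_of_skew_le_ws`), whence
  `BLMW2011_sec9_detVPws_of_skew_le_ws` reduces the fact to (iii) ([koka:08]) alone. All of them go
  through the intro / attainment lemmas `wsComplexity_le_size`, `exists_size_eq_skewComplexity`.
* `isProjection_detPoly_of_isSkew` — **universality of the determinant for skew circuits**
  (Malod–Portier 2008, Lemma 6: "If `f` is a polynomial computable by a weakly skew circuit of size
  `m`, `f` is a projection of `DET_{m+1}`"; BLMW 2011, §9.2: "if `L_ws(f) ≤ m` then `f` is a
  projection of `det_{m+1}`"), in the SPECIAL CASE of skew circuits of the tree's model: a fan-in-two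
  skew circuit with `s` gates computes a projection of `det_{3s+1}` (Toda's matrix
  `HI16Skew.todaE` merged by Hüttenhain–Ikenmeyer's Lemma 6.2, `HI16Skew.det_mergeMatrix_todaE`;
  its entries are variables and constants). `-- TODO(general form)`: weakly skew circuits and the
  printed size `m + 1` (vertex count, inputs included) are not treated.

* `exists_isWeaklySkew_of_isSkew`, `wsComplexity_attained`, `wsComplexity_le_skewComplexity` —
  BLMW 2011 §9.4 "skew circuits are weakly skew" in the gate model (a size-preserving gate-local
  normalisation `prod [] ↦ prod [const 1]`, `prod [gate j] ↦ sum [(1, gate j)]`, carried out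
  inside the proofs), whence the corrected `wsComplexity` is attained (its defining set is never
  empty) and `L_ws ≤ L_skew`.

No definitions, no named facts (net debt `0`); nothing here unfolds the defining sets of
`wsComplexity` / `skewComplexity`.

## References

* [BurgisserEtAl2011] P. Bürgisser, J. M. Landsberg, L. Manivel, J. Weyman, *An overview of
  mathematical issues arising in the geometric complexity theory approach to VP ≠ VNP*, SIAM J.
  Comput. 40 (2011), §9.1–§9.2.
* [MalodPortier2008] G. Malod, N. Portier, *Characterizing Valiant's algebraic complexity classes*,
  J. Complexity 24 (2008) 16–38, Prop. 5 and Lemma 6 (held `paper:doi-10-1016-j-jco-2006-09-006`,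
  p0013:L27, p0016:L20).
* [HuttenhainIkenmeyer2016] J. Hüttenhain, C. Ikenmeyer, *Binary determinantal complexity*, Linear
  Algebra Appl. 504 (2016), §5 (skew circuits, `VP_s^0`).
-/

noncomputable section

open MvPolynomial Finset

namespace Literature.Computability.AlgebraicComplexity

universe u v w

namespace HI16Skew

open ArithCircuit

/-! ## Junk-free normalisation (`ArithCircuit.trimJunk`) keeps skewness and input factors -/

section Trim

variable {k : Type u} [CommSemiring k] {σ : Type v}

/-- Truncating junk references keeps a gate skew (a reference may only turn into the constant
`0`). [folklore] -/
private theorem isSkew_truncate {g : Gate k σ} (hg : g.IsSkew) (n : ℕ) : (g.truncate n).IsSkew := by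
  cases g with
  | sum args => trivial
  | prod args =>
    show (args.map (Operand.truncate n)).countP Operand.isGateRef ≤ 1
    rw [List.countP_map]
    refine le_trans (List.countP_mono_left fun u _ h => ?_) hg
    cases u with
    | var i => exact h
    | const c => exact h
    | gate j => rfl

/-- `trimJunk` keeps a circuit skew. [folklore] -/
private theorem isSkew_trimJunk {P : ArithCircuit k σ} (hP : P.IsSkew) : P.trimJunk.IsSkew := by
  intro g hg
  simp only [ArithCircuit.trimJunk, List.mem_mapIdx] at hg
  obtain ⟨i, hi, rfl⟩ := hg
  exact isSkew_truncate (hP _ (List.getElem_mem hi)) _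

/-- Truncation keeps an input operand of a product gate (inputs are untouched). [folklore] -/
private theorem hasInputFactor_truncate {g : Gate k σ}
    (hg : ∀ args, g = Gate.prod args → ∃ u ∈ args, u.isGateRef = false) (n : ℕ) :
    ∀ args, g.truncate n = Gate.prod args → ∃ u ∈ args, u.isGateRef = false := by
  intro args h
  cases g with
  | sum as => exact absurd h (by simp [Gate.truncate])
  | prod as =>
    obtain ⟨u, hu, hu'⟩ := hg as rfl
    simp only [Gate.truncate, Gate.prod.injEq] at h
    subst h
    refine ⟨u.truncate n, List.mem_map.2 ⟨u, hu, rfl⟩, ?_⟩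
    cases u with
    | var i => rfl
    | const c => rfl
    | gate j => simp [Operand.isGateRef] at hu'

omit [CommSemiring k] in
/-- A gate-free circuit is well formed. [folklore] -/
private theorem wellFormed_ofConst (c : k) : (ArithCircuit.ofConst c : ArithCircuit k σ).WellFormed :=
  ⟨fun i g hg => by simp [ArithCircuit.ofConst] at hg, trivial⟩

end Trim

/-! ## Every product gate of the branching-program circuit has an input operand -/

section InputFactor

variable {k : Type u} [CommRing k] {σ : Type v}

/-- Unfolding `slc` on the empty term list. [folklore] -/
private theorem slc_nil' (gs : List (Gate k σ)) :
    slc gs ([] : List (k × Operand k σ × Operand k σ)) = (gs ++ [Gate.sum []], .gate gs.length) :=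
  rfl

/-- Unfolding `slc` on a nonempty term list. [folklore] -/
private theorem slc_cons' (gs : List (Gate k σ)) (c : k) (h a : Operand k σ)
    (rest : List (k × Operand k σ × Operand k σ)) :
    slc gs ((c, h, a) :: rest) =
      ((slc gs rest).1 ++ [Gate.prod [h, a]] ++
          [Gate.sum [(1, (slc gs rest).2), (c, .gate (slc gs rest).1.length)]],
        .gate ((slc gs rest).1.length + 1)) := rfl

/-- `slc` only emits sums and products with an input factor. [cite: MalodPortier2008, Prop. 5 (proof)] -/
private theorem slc_hasInputFactor {gs : List (Gate k σ)} (hgs : ∀ g ∈ gs, (∀ args, g = Gate.prod args → ∃ u ∈ args, u.isGateRef = false)) :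
    ∀ ts : List (k × Operand k σ × Operand k σ), (∀ t ∈ ts, t.2.2.isGateRef = false) →
      ∀ g ∈ (slc gs ts).1, (∀ args, g = Gate.prod args → ∃ u ∈ args, u.isGateRef = false)
  | [], _ => by
    rw [slc_nil']
    intro g hg
    rw [List.mem_append, List.mem_singleton] at hg
    rcases hg with hg | rfl
    · exact hgs g hg
    · intro args hargs
      cases hargs
  | (c, h, a) :: rest, hts => by
    rw [slc_cons']
    have ih := slc_hasInputFactor hgs rest fun t ht => hts t (List.mem_cons_of_mem _ ht)
    have ha : a.isGateRef = false := hts (c, h, a) (List.mem_cons_self ..)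
    intro g hg
    simp only [List.mem_append, List.mem_singleton] at hg
    rcases hg with (hg | rfl) | rfl
    · exact ih g hg
    · intro args hargs
      cases hargs
      exact ⟨a, by simp, ha⟩
    · intro args hargs
      cases hargs

variable {V : Type w} [DecidableEq V]

/-- Unfolding `roundL` on the empty list. [folklore] -/
private theorem roundL_nil' (Nc : V → V → k × Operand k σ) (bc : V → k × Operand k σ) (L : List V)
    (hy : V → Operand k σ) (gs : List (Gate k σ)) :
    roundL Nc bc L hy [] gs = (gs, fun _ => .const 0) := rfl

/-- Unfolding `roundL` on a nonempty list. [folklore] -/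
private theorem roundL_cons' (Nc : V → V → k × Operand k σ) (bc : V → k × Operand k σ) (L : List V)
    (hy : V → Operand k σ) (v : V) (rest : List V) (gs : List (Gate k σ)) :
    roundL Nc bc L hy (v :: rest) gs =
      ((roundL Nc bc L hy rest (vstep Nc bc L hy v gs).1).1,
        fun w => if w = v then (vstep Nc bc L hy v gs).2
          else (roundL Nc bc L hy rest (vstep Nc bc L hy v gs).1).2 w) := rfl

omit [DecidableEq V] in
/-- One coordinate keeps the input-factor property. [cite: MalodPortier2008, Prop. 5 (proof)] -/
private theorem vstep_hasInputFactor {Nc : V → V → k × Operand k σ} {bc : V → k × Operand k σ}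
    (hNc : ∀ v w, ReprOk (Nc v w)) (hbc : ∀ v, ReprOk (bc v)) (L : List V) (hy : V → Operand k σ)
    (v : V) {gs : List (Gate k σ)} (hgs : ∀ g ∈ gs, (∀ args, g = Gate.prod args → ∃ u ∈ args, u.isGateRef = false)) :
    ∀ g ∈ (vstep Nc bc L hy v gs).1, (∀ args, g = Gate.prod args → ∃ u ∈ args, u.isGateRef = false) := by
  unfold vstep
  refine slc_hasInputFactor hgs _ fun t ht => ?_
  rw [List.mem_cons, List.mem_map] at ht
  rcases ht with rfl | ⟨w, -, rfl⟩
  · exact (hbc v).2.1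
  · exact (hNc v w).2.1

/-- One round keeps the input-factor property. [cite: MalodPortier2008, Prop. 5 (proof)] -/
private theorem roundL_hasInputFactor {Nc : V → V → k × Operand k σ} {bc : V → k × Operand k σ}
    (hNc : ∀ v w, ReprOk (Nc v w)) (hbc : ∀ v, ReprOk (bc v)) (L : List V) (hy : V → Operand k σ) :
    ∀ (l : List V) {gs : List (Gate k σ)}, (∀ g ∈ gs, (∀ args, g = Gate.prod args → ∃ u ∈ args, u.isGateRef = false)) →
      ∀ g ∈ (roundL Nc bc L hy l gs).1,
        (∀ args, g = Gate.prod args → ∃ u ∈ args, u.isGateRef = false)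
  | [], gs, hgs => by
    rw [roundL_nil']
    exact hgs
  | v :: rest, gs, hgs => by
    rw [roundL_cons']
    exact roundL_hasInputFactor hNc hbc L hy rest (vstep_hasInputFactor hNc hbc L hy v hgs)

/-- All rounds keep the input-factor property. [cite: MalodPortier2008, Prop. 5 (proof)] -/
private theorem rounds_hasInputFactor {Nc : V → V → k × Operand k σ} {bc : V → k × Operand k σ}
    (hNc : ∀ v w, ReprOk (Nc v w)) (hbc : ∀ v, ReprOk (bc v)) (L : List V) :
    ∀ r : ℕ, ∀ g ∈ (rounds Nc bc L r).1, (∀ args, g = Gate.prod args → ∃ u ∈ args, u.isGateRef = false)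
  | 0 => by
    intro g hg
    simp [rounds] at hg
  | r + 1 => by
    show ∀ g ∈ (roundL Nc bc L (rounds Nc bc L r).2 L (rounds Nc bc L r).1).1,
      (∀ args, g = Gate.prod args → ∃ u ∈ args, u.isGateRef = false)
    exact roundL_hasInputFactor hNc hbc L _ L (rounds_hasInputFactor hNc hbc L r)

/-- **Every product gate of `abpCircuit` has an input operand.**
[cite: MalodPortier2008, Prop. 5 (proof)] -/
theorem abpCircuit_hasInputFactor {Nc : V → V → k × Operand k σ} {bc ac : V → k × Operand k σ}
    (hNc : ∀ v w, ReprOk (Nc v w)) (hbc : ∀ v, ReprOk (bc v)) (hac : ∀ v, ReprOk (ac v))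
    (L : List V) (m : ℕ) :
    ∀ g ∈ (abpCircuit Nc bc ac L m).gates, (∀ args, g = Gate.prod args → ∃ u ∈ args, u.isGateRef = false) := by
  show ∀ g ∈ (slc (rounds Nc bc L m).1 _).1, (∀ args, g = Gate.prod args → ∃ u ∈ args, u.isGateRef = false)
  refine slc_hasInputFactor (rounds_hasInputFactor hNc hbc L m) _ fun t ht => ?_
  rw [List.mem_map] at ht
  obtain ⟨v, -, rfl⟩ := ht
  exact (hac v).2.1

omit [CommRing k] [DecidableEq V] in
/-- A circuit all of whose product gates have an input operand is weakly skew
(BLMW 2011, §9.1: an input vertex is a separate subcircuit). [cite: BurgisserEtAl2011, §9.1 (weakly-skew circuits)] -/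
theorem isWeaklySkew_of_hasInputFactor {τ : Type w} {P : ArithCircuit k τ}
    (hP : ∀ g ∈ P.gates, (∀ args, g = Gate.prod args → ∃ u ∈ args, u.isGateRef = false)) :
    P.IsWeaklySkew := by
  intro i args hg _
  obtain ⟨u, hu, hu'⟩ : ∃ u ∈ args, u.isGateRef = false :=
    hP (Gate.prod args) (List.mem_of_getElem? hg) args rfl
  exact ⟨u, hu, Or.inl hu'⟩

/-- An admissible weight is `c • ival a` for a sign constant `c` and an input `a ∈ {1, X_i}`.
[folklore] -/
private theorem exists_repr' {e : MvPolynomial σ k} (he : IsSInput e) :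
    ∃ p : k × Operand k σ, IsSignConstant p.1 ∧ IsInput p.2 ∧ e = p.1 • ival p.2 := by
  rcases he with rfl | rfl | rfl | ⟨x, rfl⟩
  · exact ⟨(0, .const 1), isSignConstant_zero, ⟨rfl, isSignConstant_one⟩, by simp⟩
  · refine ⟨(1, .const 1), isSignConstant_one, ⟨rfl, isSignConstant_one⟩, ?_⟩
    simp [ival, Operand.eval]
  · refine ⟨(-1, .const 1), isSignConstant_neg_one, ⟨rfl, isSignConstant_one⟩, ?_⟩
    simp [ival, Operand.eval]
  · refine ⟨(1, .var x), isSignConstant_one, ⟨rfl, trivial⟩, ?_⟩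
    simp [ival, Operand.eval]

variable [Fintype V]

/-- **The branching-program circuit, weakly skew version**: as `exists_skewCircuit_dotProduct`,
with the circuit also weakly skew in the sense of `ArithCircuit.IsWeaklySkew`.
[cite: MalodPortier2008, Prop. 5 (proof)] -/
theorem exists_wsCircuit_dotProduct (N : Matrix V V (MvPolynomial σ k))
    (a b : V → MvPolynomial σ k) (m : ℕ) (hN : ∀ v w, IsSInput (N v w))
    (ha : ∀ v, IsSInput (a v)) (hb : ∀ v, IsSInput (b v)) :
    ∃ P : ArithCircuit k σ, P.IsFanInTwo ∧ P.HasSignConstants ∧ P.IsSkew ∧ P.IsWeaklySkew ∧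
      P.eval = a ⬝ᵥ (GKKP2011.geomInv N m).mulVec b ∧
      P.size ≤ (m + 1) * (2 * Fintype.card V + 3) ^ 2 := by
  classical
  choose Nc hNc1 hNc2 hNc3 using fun v w => exists_repr' (hN v w)
  choose bc hbc1 hbc2 hbc3 using fun v => exists_repr' (hb v)
  choose ac hac1 hac2 hac3 using fun v => exists_repr' (ha v)
  obtain ⟨h1, h2, h3, h4, h5⟩ := abpCircuit_spec (fun v w => ⟨hNc1 v w, hNc2 v w⟩)
    (fun v => ⟨hbc1 v, hbc2 v⟩) (fun v => ⟨hac1 v, hac2 v⟩) N a b hNc3 hac3 hbc3 m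
  exact ⟨abpCircuit Nc bc ac univ.toList m, h1, h2, h3,
    isWeaklySkew_of_hasInputFactor (abpCircuit_hasInputFactor (fun v w => ⟨hNc1 v w, hNc2 v w⟩)
      (fun v => ⟨hbc1 v, hbc2 v⟩) (fun v => ⟨hac1 v, hac2 v⟩) _ m), h4, h5⟩

end InputFactor

/-! ## `(det_n) ∈ VP_ws` (BLMW 2011, §9.1 (i)) -/

section DetWs

variable (k : Type u) [CommRing k]

/-- **A weakly skew (indeed skew) circuit for `det_n` of size `≤ (n+2)(4n³+7)²`** over every
commutative ring (Malod–Portier 2008, Prop. 5; BLMW 2011, §9.1 (i) with Berkowitz's `O(n⁵)`,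
here `O(n⁷)`). [cite: MalodPortier2008, Prop. 5] -/
theorem exists_wsCircuit_detPoly (n : ℕ) :
    ∃ P : ArithCircuit k (Fin n × Fin n), P.IsFanInTwo ∧ P.HasSignConstants ∧ P.IsSkew ∧
      P.IsWeaklySkew ∧ P.eval = detPoly (Fin n) k ∧ P.size ≤ (n + 2) * (4 * n ^ 3 + 7) ^ 2 := by
  rcases Nat.eq_zero_or_pos n with rfl | hn
  · refine ⟨ArithCircuit.ofConst 1, fun g hg => by simp [ArithCircuit.ofConst] at hg,
      ⟨fun g hg => by simp [ArithCircuit.ofConst] at hg, isSignConstant_one⟩,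
      fun g hg => by simp [ArithCircuit.ofConst] at hg,
      fun i args hg => by simp [ArithCircuit.ofConst] at hg, ?_,
      by simp [ArithCircuit.ofConst, size]⟩
    rw [ArithCircuit.eval_ofConst, map_one, detPoly]
    exact (Matrix.det_isEmpty).symm
  · obtain ⟨P, h1, h2, h3, hws, h4, h5⟩ := exists_wsCircuit_dotProduct (GKKP2011.bigN k n)
      (GKKP2011.srcVec k n) (GKKP2011.snkVec k n) (n + 1) (isSInput_bigN k n)
      (isSInput_srcVec k n) (isSInput_snkVec k n)
    refine ⟨P, h1, h2, h3, hws, ?_, ?_⟩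
    · rw [h4, ← GKKP2011.abpValue_eq_detPoly (k := k) (n := n) hn.ne']
      rfl
    · rw [card_vtx] at h5
      calc P.size ≤ (n + 1 + 1) * (2 * (2 * n ^ 3 + 2) + 3) ^ 2 := h5
        _ = (n + 2) * (4 * n ^ 3 + 7) ^ 2 := by ring

/-- **The det circuit, junk-free**: as `exists_wsCircuit_detPoly`, with the circuit also
`ArithCircuit.WellFormed` (every operand references an earlier gate; obtained by
`ArithCircuit.trimJunk`, which keeps size, value, fan-in, sign constants, skewness and the input
operand of every product gate). [cite: MalodPortier2008, Prop. 5] -/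
theorem exists_wsCircuit_detPoly_wellFormed (n : ℕ) :
    ∃ P : ArithCircuit k (Fin n × Fin n), P.WellFormed ∧ P.IsFanInTwo ∧ P.HasSignConstants ∧
      P.IsSkew ∧ P.IsWeaklySkew ∧ P.eval = detPoly (Fin n) k ∧
      P.size ≤ (n + 2) * (4 * n ^ 3 + 7) ^ 2 := by
  classical
  rcases Nat.eq_zero_or_pos n with rfl | hn
  · refine ⟨ArithCircuit.ofConst 1, wellFormed_ofConst 1,
      fun g hg => by simp [ArithCircuit.ofConst] at hg,
      ⟨fun g hg => by simp [ArithCircuit.ofConst] at hg, isSignConstant_one⟩,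
      fun g hg => by simp [ArithCircuit.ofConst] at hg,
      fun i args hg => by simp [ArithCircuit.ofConst] at hg, ?_,
      by simp [ArithCircuit.ofConst, size]⟩
    rw [ArithCircuit.eval_ofConst, map_one, detPoly]
    exact (Matrix.det_isEmpty).symm
  · choose Nc hNc1 hNc2 hNc3 using fun v w => exists_repr' (isSInput_bigN k n v w)
    choose bc hbc1 hbc2 hbc3 using fun v => exists_repr' (isSInput_snkVec k n v)
    choose ac hac1 hac2 hac3 using fun v => exists_repr' (isSInput_srcVec k n v)
    obtain ⟨h1, h2, h3, h4, h5⟩ := abpCircuit_spec (fun v w => ⟨hNc1 v w, hNc2 v w⟩)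
      (fun v => ⟨hbc1 v, hbc2 v⟩) (fun v => ⟨hac1 v, hac2 v⟩) (GKKP2011.bigN k n)
      (GKKP2011.srcVec k n) (GKKP2011.snkVec k n) hNc3 hac3 hbc3 (n + 1)
    have hin := abpCircuit_hasInputFactor (fun v w => ⟨hNc1 v w, hNc2 v w⟩)
      (fun v => ⟨hbc1 v, hbc2 v⟩) (fun v => ⟨hac1 v, hac2 v⟩) (univ : Finset (GKKP2011.Vtx n)).toList
      (n + 1)
    refine ⟨(abpCircuit Nc bc ac univ.toList (n + 1)).trimJunk, wellFormed_trimJunk _, h1.trimJunk,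
      h2.trimJunk, isSkew_trimJunk h3, ?_, ?_, ?_⟩
    · refine isWeaklySkew_of_hasInputFactor fun g hg => ?_
      simp only [ArithCircuit.trimJunk, List.mem_mapIdx] at hg
      obtain ⟨i, hi, rfl⟩ := hg
      exact hasInputFactor_truncate (hin _ (List.getElem_mem hi)) _
    · rw [eval_trimJunk, h4, ← GKKP2011.abpValue_eq_detPoly (k := k) (n := n) hn.ne']
      rfl
    · rw [size_trimJunk]
      rw [card_vtx] at h5
      calc (abpCircuit Nc bc ac univ.toList (n + 1)).size
          ≤ (n + 1 + 1) * (2 * (2 * n ^ 3 + 2) + 3) ^ 2 := h5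
        _ = (n + 2) * (4 * n ^ 3 + 7) ^ 2 := by ring

end DetWs

/-! ## Universality of the determinant for skew circuits (Malod–Portier 2008, Lemma 6) -/

section Universality

variable {k : Type u} [CommRing k] {τ : Type v} (P : ArithCircuit k τ)

omit P in
/-- `|TV s| = 3s + 2`. [folklore] -/
private theorem card_TV' (s : ℕ) : Fintype.card (TV s) = 3 * s + 2 := by
  simp only [Fintype.card_sum, Fintype.card_unit, Fintype.card_prod, Fintype.card_fin]
  ring

omit P in
/-- `0` is a constant. [folklore] -/
private theorem isXC_zero :
    (∃ v, (0 : MvPolynomial τ k) = X v) ∨ ∃ c, (0 : MvPolynomial τ k) = C c :=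
  Or.inr ⟨0, (map_zero C).symm⟩

omit P in
/-- `1` is a constant. [folklore] -/
private theorem isXC_one :
    (∃ v, (1 : MvPolynomial τ k) = X v) ∨ ∃ c, (1 : MvPolynomial τ k) = C c :=
  Or.inr ⟨1, (map_one C).symm⟩

/-- Operand labels are variables or constants. [folklore] -/
private theorem isXC_opLab (i : ℕ) (u : Operand k τ) :
    (∃ v, opLab P i u = X v) ∨ ∃ c, opLab P i u = C c := by
  cases u with
  | var x => exact Or.inl ⟨x, rfl⟩
  | const c => exact Or.inr ⟨c, rfl⟩
  | gate j =>
    simp only [opLab]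
    split_ifs
    · exact isXC_one
    · exact isXC_zero

/-- The entries of Toda's matrix are variables or constants. [folklore] -/
private theorem isXC_todaE (u v : TV P.size) :
    (∃ x, todaE P u v = X x) ∨ ∃ c, todaE P u v = C c := by
  rcases v with (⟨⟩ | ⟨⟩) | (i | ⟨i, e⟩)
  · exact isXC_zero
  · rw [show todaE P u (Sum.inl (Sum.inr PUnit.unit)) =
        (if u = opSrc P P.size P.output then opLab P P.size P.output else 0) from rfl]
    split_ifs
    · exact isXC_opLab P _ _
    · exact isXC_zero
  · rcases u with (y | y) | (j | ⟨i', e'⟩)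
    · exact isXC_zero
    · exact isXC_zero
    · exact isXC_zero
    · rw [show todaE P (Sum.inr (Sum.inr (i', e'))) (Sum.inr (Sum.inl i)) =
          (if (i', e').1 = i then outLab P i (i', e').2 else 0) from rfl]
      split_ifs
      · unfold outLab
        cases slot P i (i', e').2 with
        | none => exact isXC_zero
        | some d => exact isXC_opLab P _ _
      · exact isXC_zero
  · rw [show todaE P u (Sum.inr (Sum.inr (i, e))) =
        (if u = inSrc P (i, e).1 (i, e).2 then inLab P (i, e).1 (i, e).2 else 0) from rfl]
    split_ifs
    · unfold inLab
      cases slot P (i, e).1 (i, e).2 with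
      | none => exact isXC_zero
      | some d => exact isXC_opLab P _ _
    · exact isXC_zero

/-- Toda's matrix has no loops (its tail vertices are never the head). [folklore] -/
private theorem todaE_self (v : TV P.size) : todaE P v v = 0 := by
  have hsrc : ∀ (i : ℕ) (u : Operand k τ), opSrc P i u ≠ vT ∧ ∀ j e, opSrc P i u ≠ vM j e := by
    intro i u
    cases u with
    | var x => exact ⟨by simp [opSrc], fun j e => by simp [opSrc]⟩
    | const c => exact ⟨by simp [opSrc], fun j e => by simp [opSrc]⟩
    | gate j =>
      simp only [opSrc]
      split_ifs <;> exact ⟨by simp, fun j e => by simp⟩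
  rcases v with (⟨⟩ | ⟨⟩) | (i | ⟨i, e⟩)
  · rfl
  · show (if (vT : TV P.size) = opSrc P P.size P.output then _ else _) = 0
    rw [if_neg (fun h => (hsrc _ _).1 h.symm)]
  · rfl
  · show (if (vM i e : TV P.size) = inSrc P i e then _ else _) = 0
    rw [if_neg]
    intro h
    unfold inSrc at h
    cases hs : slot P i e with
    | none => rw [hs] at h; exact absurd h (by simp)
    | some d => rw [hs] at h; exact (hsrc _ _).2 i e h.symm

/-- The entries of the merged matrix are variables or constants. [folklore] -/
private theorem isXC_mergeMatrix (u v : {v : TV P.size // v ≠ vT}) :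
    (∃ x, mergeMatrix (todaE P) vS vT u v = X x) ∨ ∃ c, mergeMatrix (todaE P) vS vT u v = C c := by
  simp only [mergeMatrix, Matrix.of_apply, Matrix.add_apply]
  by_cases h : u.1 = (if v.1 = vS then vT else v.1)
  · rw [← h, Matrix.one_apply_eq, todaE_self, add_zero]
    exact isXC_one
  · rw [Matrix.one_apply_ne h, zero_add]
    exact isXC_todaE P _ _

/-- **Universality of the determinant for skew circuits** (Malod–Portier 2008, Lemma 6: "If `f`
is a polynomial computable by a weakly skew circuit of size `m`, `f` is a projection of
`DET_{m+1}`"; BLMW 2011, §9.2; Toda 1992) — special case: a fan-in-two SKEW circuit with `s`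
gates (the tree's gate count) computes a Valiant projection of `det_{3s+1}` (Toda's matrix merged
à la Hüttenhain–Ikenmeyer, `HI16Skew.det_mergeMatrix_todaE`), over every commutative ring.
`-- TODO(general form)`: weakly skew circuits; the printed size `m + 1` counts input vertices.
[cite: MalodPortier2008, Lemma 6] -/
theorem isProjection_detPoly_of_isSkew (h2 : P.IsFanInTwo) (hsk : P.IsSkew) :
    IsProjection P.eval (detPoly (Fin (3 * P.size + 1)) k) := by
  classical
  have hcard : Fintype.card {v : TV P.size // v ≠ vT} = 3 * P.size + 1 := by
    simp only [Fintype.card_subtype_compl, Fintype.card_unique, card_TV']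
    omega
  obtain ⟨e⟩ : Nonempty ({v : TV P.size // v ≠ vT} ≃ Fin (3 * P.size + 1)) :=
    ⟨Fintype.equivFinOfCardEq hcard⟩
  refine ⟨fun ij => Matrix.reindex e e (mergeMatrix (todaE P) vS vT) ij.1 ij.2,
    fun ij => isXC_mergeMatrix P _ _, ?_⟩
  rw [detPoly, AlgHom.map_det, Matrix.mvPolynomialX_mapMatrix_aeval, Matrix.det_reindex_self,
    det_mergeMatrix_todaE P h2 hsk]

end Universality

/-! ## Every polynomial has a (well-formed) fan-in-two skew circuit -/

section SkewExists

variable {k : Type u} [CommSemiring k] {σ : Type v}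

omit [CommSemiring k] in
/-- Shifting gate references keeps a gate skew. [folklore] -/
private theorem isSkew_shift {g : Gate k σ} (hg : g.IsSkew) (n : ℕ) : (g.shift n).IsSkew := by
  cases g with
  | sum args => trivial
  | prod args =>
    show (args.map (Operand.shift n)).countP Operand.isGateRef ≤ 1
    rw [List.countP_map]
    have : args.countP (Operand.isGateRef ∘ Operand.shift n) = args.countP Operand.isGateRef :=
      List.countP_congr fun u _ => by cases u <;> exact Iff.rfl
    rw [this]
    exact hg

omit [CommSemiring k] in
/-- A gate-free circuit is skew. [folklore] -/
private theorem isSkew_ofConst (c : k) : (ArithCircuit.ofConst c : ArithCircuit k σ).IsSkew :=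
  fun g hg => by simp [ArithCircuit.ofConst] at hg

/-- `P + Q` is skew if `P`, `Q` are. [folklore] -/
private theorem isSkew_add {P Q : ArithCircuit k σ} (hP : P.IsSkew) (hQ : Q.IsSkew) :
    (P.add Q).IsSkew := by
  intro g hg
  simp only [ArithCircuit.add, ArithCircuit.append, List.mem_append, List.mem_map,
    List.mem_singleton] at hg
  rcases hg with (hg | ⟨g', hg', rfl⟩) | rfl
  · exact hP g hg
  · exact isSkew_shift (hQ g' hg') _
  · trivial

omit [CommSemiring k] in
/-- `c • P` is skew if `P` is. [folklore] -/
private theorem isSkew_smul {P : ArithCircuit k σ} (hP : P.IsSkew) (c : k) : (P.smul c).IsSkew := by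
  intro g hg
  simp only [ArithCircuit.smul, List.mem_append, List.mem_singleton] at hg
  rcases hg with hg | rfl
  · exact hP g hg
  · trivial

/-- `P * X_i` is skew if `P` is (the new product gate has the input `X_i` as an operand).
[cite: HuttenhainIkenmeyer2016, §5] -/
private theorem isSkew_mul_ofVar {P : ArithCircuit k σ} (hP : P.IsSkew) (i : σ) :
    (P.mul (ArithCircuit.ofVar i)).IsSkew := by
  intro g hg
  simp only [ArithCircuit.mul, ArithCircuit.append, ArithCircuit.ofVar, List.map_nil,
    List.append_nil, List.mem_append, List.mem_singleton] at hg
  rcases hg with hg | rfl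
  · exact hP g hg
  · show [P.output.truncate P.size, Operand.var i].countP Operand.isGateRef ≤ 1
    have hv : (Operand.var i : Operand k σ).isGateRef = false := rfl
    rw [List.countP_cons, List.countP_cons, List.countP_nil, hv]
    cases (P.output.truncate P.size).isGateRef <;> simp

/-- Multiplying a skew circuit by a power of a variable keeps it skew. [folklore] -/
private theorem exists_isSkew_mul_X_pow {P : ArithCircuit k σ} (h2 : P.IsFanInTwo) (hs : P.IsSkew)
    (i : σ) : ∀ e : ℕ, ∃ Q : ArithCircuit k σ, Q.IsFanInTwo ∧ Q.IsSkew ∧ Q.eval = P.eval * X i ^ e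
  | 0 => ⟨P, h2, hs, by simp⟩
  | e + 1 => by
    obtain ⟨Q, hQ2, hQs, hQe⟩ := exists_isSkew_mul_X_pow h2 hs i e
    refine ⟨Q.mul (ArithCircuit.ofVar i), hQ2.mul (IsFanInTwo.ofVar i), isSkew_mul_ofVar hQs i, ?_⟩
    rw [mul_eval, hQe, ArithCircuit.eval_ofVar, pow_succ, mul_assoc]

/-- A monomial's variable part has a skew circuit. [folklore] -/
private theorem exists_isSkew_prod_X_pow (m : σ →₀ ℕ) :
    ∀ L : List σ, ∃ Q : ArithCircuit k σ, Q.IsFanInTwo ∧ Q.IsSkew ∧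
      Q.eval = (L.map fun i => (X i : MvPolynomial σ k) ^ m i).prod
  | [] => ⟨ArithCircuit.ofConst 1, IsFanInTwo.ofConst 1, isSkew_ofConst 1, by simp⟩
  | i :: L => by
    obtain ⟨Q, hQ2, hQs, hQe⟩ := exists_isSkew_prod_X_pow m L
    obtain ⟨R, hR2, hRs, hRe⟩ := exists_isSkew_mul_X_pow hQ2 hQs i (m i)
    refine ⟨R, hR2, hRs, ?_⟩
    rw [hRe, hQe, List.map_cons, List.prod_cons, mul_comm]

/-- A sum of polynomials with skew circuits has a skew circuit. [folklore] -/
private theorem exists_isSkew_sum :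
    ∀ L : List (MvPolynomial σ k), (∀ g ∈ L, ∃ Q : ArithCircuit k σ, Q.IsFanInTwo ∧ Q.IsSkew ∧
      Q.eval = g) → ∃ Q : ArithCircuit k σ, Q.IsFanInTwo ∧ Q.IsSkew ∧ Q.eval = L.sum
  | [], _ => ⟨ArithCircuit.ofConst 0, IsFanInTwo.ofConst 0, isSkew_ofConst 0, by simp⟩
  | g :: L, hL => by
    obtain ⟨Q, hQ2, hQs, hQe⟩ := hL g (List.mem_cons_self ..)
    obtain ⟨R, hR2, hRs, hRe⟩ := exists_isSkew_sum L fun g' hg' => hL g' (List.mem_cons_of_mem _ hg')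
    refine ⟨Q.add R, hQ2.add hR2, isSkew_add hQs hRs, ?_⟩
    rw [add_eval, hQe, hRe, List.sum_cons]

/-- **Every polynomial is computed by some fan-in-two skew circuit** (write it as a sum of
monomials, each a chain of multiplications by input variables; so the infimum defining
`skewComplexity` is over a nonempty set — the remark after BLMW 2011 §9.4's definition in
`BLMW11KroneckerApproximation.lean`). [cite: BurgisserEtAl2011, §9.4 (skew circuits)] -/
theorem exists_isSkew_computes (f : MvPolynomial σ k) :
    ∃ P : ArithCircuit k σ, P.IsFanInTwo ∧ P.IsSkew ∧ P.Computes f := by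
  classical
  have hmon : ∀ m : σ →₀ ℕ, ∃ Q : ArithCircuit k σ, Q.IsFanInTwo ∧ Q.IsSkew ∧
      Q.eval = monomial m (coeff m f) := by
    intro m
    obtain ⟨Q, hQ2, hQs, hQe⟩ := exists_isSkew_prod_X_pow (k := k) m m.support.toList
    refine ⟨Q.smul (coeff m f), hQ2.smul, isSkew_smul hQs _, ?_⟩
    rw [ArithCircuit.eval_smul, hQe, Finset.prod_map_toList, monomial_eq, smul_eq_C_mul,
      Finsupp.prod]
  obtain ⟨P, h2, hs, he⟩ := exists_isSkew_sum
    (f.support.toList.map fun m => monomial m (coeff m f)) fun g hg => by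
      rw [List.mem_map] at hg
      obtain ⟨m, -, rfl⟩ := hg
      exact hmon m
  refine ⟨P, h2, hs, ?_⟩
  rw [ArithCircuit.Computes, he, Finset.sum_map_toList]
  exact (as_sum f).symm

/-- **Every polynomial is computed by some WELL-FORMED fan-in-two skew circuit** (junk
references removed by `ArithCircuit.trimJunk`) — the nonemptiness of the defining set of
`skewComplexity` in either of its forms. [cite: BurgisserEtAl2011, §9.4 (skew circuits)] -/
theorem exists_wellFormed_isSkew_computes (f : MvPolynomial σ k) :
    ∃ P : ArithCircuit k σ, P.WellFormed ∧ P.IsFanInTwo ∧ P.IsSkew ∧ P.Computes f := by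
  obtain ⟨P, h2, hs, hc⟩ := exists_isSkew_computes f
  refine ⟨P.trimJunk, wellFormed_trimJunk P, h2.trimJunk, isSkew_trimJunk hs, ?_⟩
  rw [ArithCircuit.Computes, eval_trimJunk]
  exact hc

end SkewExists

/-! ## BLMW 2011 §9.1 (i), §9.2 (ii) ⇐ §9.4 (iii), for the CORRECTED (well-formed) notions

Erratum A14 (cell `val-lit`, 2026-08-26): `wsComplexity` / `skewComplexity` now range over
WELL-FORMED circuits; every statement below goes through the intro lemmas
`wsComplexity_le_size` / `exists_size_eq_skewComplexity` of `BLMW11KroneckerApproximation`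
(A14 step (B), with the attainment lemmas), never through the shape of the defining sets. -/

section ClassLevel

variable (k : Type u) [CommRing k]

/-- **`L_ws(det_n) ≤ (n+2)(4n³+7)²`** for the tree's gate count and the corrected (well-formed)
`wsComplexity` (BLMW 2011 §9.1 (i): "Since `L_ws(det_n) = O(n⁵)` [Berkowitz], we have
`(det_n) ∈ VP_ws`"; here via the Mahajan–Vinay / GKKP branching program, `O(n⁷)`, over every
commutative ring). [cite: BurgisserEtAl2011, §9.1 (i)] -/
theorem wsComplexity_detPoly_le (n : ℕ) :
    wsComplexity (detPoly (Fin n) k) ≤ (n + 2) * (4 * n ^ 3 + 7) ^ 2 := by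
  obtain ⟨P, hwf, h2, _, _, hws, hev, hsz⟩ := exists_wsCircuit_detPoly_wellFormed k n
  exact (wsComplexity_le_size (f := detPoly (Fin n) k) P hwf h2 hws hev).trans hsz

/-- **BLMW 2011 §9.1 (i): `(det_n) ∈ VP_ws`** — conjunct (i) of `BLMW2011_sec9_detVPws`, over
every commutative ring, for the corrected notion. [cite: BurgisserEtAl2011, §9.1 (i)] -/
theorem isVPwsFamily_detPoly : IsVPwsFamily (fun n => detPoly (Fin n) k) := by
  have hpoly : IsPBounded fun m => (m + 2) * (4 * m ^ 3 + 7) ^ 2 :=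
    IsPBounded.mul_holds (IsPBounded.add_holds IsPBounded.id (IsPBounded.const 2))
      (IsPBounded.pow_holds (IsPBounded.add_holds (IsPBounded.mul_holds (IsPBounded.const 4)
        (IsPBounded.pow_holds IsPBounded.id 3)) (IsPBounded.const 7)) 2)
  exact hpoly.mono fun n => wsComplexity_detPoly_le k n

end ClassLevel

section Attain

variable {k : Type u} [CommSemiring k] {σ : Type v}

/-- **The (corrected) skew complexity is attained**: every polynomial has a well-formed fan-in-two
skew circuit of size exactly `skewComplexity f` (the elimination lemma
`exists_size_eq_skewComplexity` of `BLMW11KroneckerApproximation`, fed with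
`exists_wellFormed_isSkew_computes`). [cite: BurgisserEtAl2011, §9.4 (skew circuits)] -/
theorem skewComplexity_attained (f : MvPolynomial σ k) :
    ∃ P : ArithCircuit k σ, P.WellFormed ∧ P.IsFanInTwo ∧ P.IsSkew ∧ P.Computes f ∧
      P.size = skewComplexity f :=
  exists_size_eq_skewComplexity (exists_wellFormed_isSkew_computes f)

end Attain

section Completeness

variable {k : Type u} [CommRing k]

/-- **BLMW 2011 §9.2 (ii) from §9.4 (iii)**: if skew circuits simulate weakly skew ones with a
linear size factor `c` (conjunct (iii) of `BLMW2011_sec9_detVPws`, [koka:08]), then every `VP_ws`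
family is a p-projection of `(det_n)` — by the universality of the determinant for skew circuits
(`isProjection_detPoly_of_isSkew`, Malod–Portier 2008 Lemma 6) applied to a size-optimal
well-formed skew circuit (`skewComplexity_attained`): `f_n` is a projection of
`det_{3·L_skew(f_n)+1}` and `3·L_skew(f_n)+1 ≤ 3c·L_ws(f_n)+1` is p-bounded.
[cite: BurgisserEtAl2011, §9.2 (VP_ws-completeness of det)] -/
theorem isPProjection_detPoly_of_skew_le_ws (c : ℕ)
    (hc : ∀ {σ : Type} [Fintype σ] (f : MvPolynomial σ k), skewComplexity f ≤ c * wsComplexity f)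
    (v : ℕ → ℕ) (f : ∀ n, MvPolynomial (Fin (v n)) k) (hf : IsVPwsFamily f) :
    IsPProjection f fun n => detPoly (Fin n) k := by
  classical
  choose P _ h2 hsk hcomp hsize using fun n => skewComplexity_attained (f n)
  refine ⟨fun n => 3 * (P n).size + 1, ?_, fun n => ?_⟩
  · obtain ⟨d, hd⟩ := hf
    have hpoly : IsPBounded fun n => 3 * (c * (n ^ d + d)) + 1 :=
      IsPBounded.add_holds (IsPBounded.mul_holds (IsPBounded.const 3)
        (IsPBounded.mul_holds (IsPBounded.const c) ⟨d, fun n => le_rfl⟩)) (IsPBounded.const 1)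
    refine hpoly.mono fun n => ?_
    have h1 : (P n).size ≤ c * (n ^ d + d) :=
      (hsize n).le.trans ((hc (f n)).trans (Nat.mul_le_mul_left c (hd n)))
    exact Nat.add_le_add_right (Nat.mul_le_mul_left 3 h1) 1
  · have h := isProjection_detPoly_of_isSkew (P n) (h2 n) (hsk n)
    have he : (P n).eval = f n := hcomp n
    rwa [he] at h

end Completeness

/-! ## Skew ⇒ weakly skew at the same size: `L_ws ≤ L_skew`, and `L_ws` is attained

BLMW 2011 §9.4: "Skew circuits are weakly skew" (print, vertex model). In the tree's gate model a
skew product gate may be NULLARY (`prod []`) or UNARY on a gate reference (`prod [gate j]`), and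
these need not satisfy `IsWeaklySkew`'s clause; the size-preserving gate-local normalisation
`prod [] ↦ prod [const 1]`, `prod [gate j] ↦ sum [(1, gate j)]` repairs this without changing
values, fan-in, or well-formedness, after which every product gate has an input operand
(`isWeaklySkew_of_hasInputFactor`). The normalisation is carried out inside the proofs (no
definitions). -/

section SkewToWs

variable {k : Type u} [CommSemiring k] {σ : Type v}

/-- One gate: a fan-in-two skew gate has a same-valued replacement of fan-in at most two whose
operands obey the same reference bounds and which, if a product gate, has an input operand
(`prod [] ↦ prod [const 1]`, `prod [gate j] ↦ sum [(1, gate j)]`, identity otherwise). [folklore] -/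
private theorem exists_wsNormGate (g : Gate k σ) (hs : g.IsSkew) (h2 : g.fanIn ≤ 2) :
    ∃ g' : Gate k σ, (∀ vals : List (MvPolynomial σ k), g'.eval vals = g.eval vals) ∧
      g'.fanIn ≤ 2 ∧ (∀ args, g' = Gate.prod args → ∃ u ∈ args, u.isGateRef = false) ∧
      ∀ n, (∀ u ∈ g.args, u.RefsBelow n) → ∀ u ∈ g'.args, u.RefsBelow n := by
  match g, hs, h2 with
  | .sum args, _, h2 => exact ⟨.sum args, fun _ => rfl, h2, fun _ h => by simp at h, fun _ h => h⟩
  | .prod [], _, _ =>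
    refine ⟨.prod [.const 1], fun vals => ?_, by simp [Gate.fanIn, Gate.args], fun args h => ?_,
      fun n _ u hu => ?_⟩
    · simp [Gate.eval, Operand.eval]
    · simp only [Gate.prod.injEq] at h
      subst h
      exact ⟨.const 1, by simp, rfl⟩
    · simp only [Gate.args, List.mem_singleton] at hu
      subst hu; trivial
  | .prod [.gate j], _, _ =>
    refine ⟨.sum [(1, .gate j)], fun vals => ?_, by simp [Gate.fanIn, Gate.args],
      fun args h => by simp at h, fun n h u hu => ?_⟩
    · simp [Gate.eval]
    · simp only [Gate.args, List.map_cons, List.map_nil, List.mem_singleton] at hu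
      subst hu
      exact h _ (by simp [Gate.args])
  | .prod [.var i], _, h2 =>
    exact ⟨.prod [.var i], fun _ => rfl, h2, fun args h => by
      simp only [Gate.prod.injEq] at h; subst h; exact ⟨.var i, by simp, rfl⟩, fun _ h => h⟩
  | .prod [.const c], _, h2 =>
    exact ⟨.prod [.const c], fun _ => rfl, h2, fun args h => by
      simp only [Gate.prod.injEq] at h; subst h; exact ⟨.const c, by simp, rfl⟩, fun _ h => h⟩
  | .prod (u :: v :: rest), hs, h2 =>
    have hrest : rest = [] := by
      simp only [Gate.fanIn, Gate.args, List.length_cons] at h2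
      exact List.eq_nil_of_length_eq_zero (by omega)
    subst hrest
    refine ⟨.prod [u, v], fun _ => rfl, h2, fun args h => ?_, fun _ h => h⟩
    simp only [Gate.prod.injEq] at h
    subst h
    simp only [Gate.IsSkew, List.countP_cons, List.countP_nil] at hs
    cases u with
    | var i => exact ⟨.var i, by simp, rfl⟩
    | const c => exact ⟨.const c, by simp, rfl⟩
    | gate j =>
      cases v with
      | var i => exact ⟨.var i, by simp, rfl⟩
      | const c => exact ⟨.const c, by simp, rfl⟩
      | gate l => simp [Operand.isGateRef] at hs

/-- Gate lists: normalising every gate of a fan-in-two skew gate list keeps length and value list,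
fan-in two and the reference bounds, and gives every product gate an input operand. [folklore] -/
private theorem exists_wsNormGates (gs : List (Gate k σ)) (hs : ∀ g ∈ gs, g.IsSkew)
    (h2 : ∀ g ∈ gs, g.fanIn ≤ 2) :
    ∃ gs' : List (Gate k σ), gs'.length = gs.length ∧ gateValues gs' = gateValues gs ∧
      (∀ g ∈ gs', g.fanIn ≤ 2) ∧
      (∀ g ∈ gs', ∀ args, g = Gate.prod args → ∃ u ∈ args, u.isGateRef = false) ∧
      ∀ (i : ℕ) (g' : Gate k σ), gs'[i]? = some g' → ∃ g, gs[i]? = some g ∧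
        ∀ n, (∀ u ∈ g.args, u.RefsBelow n) → ∀ u ∈ g'.args, u.RefsBelow n := by
  induction gs using List.reverseRecOn with
  | nil => exact ⟨[], rfl, rfl, by simp, by simp, by simp⟩
  | append_singleton gs g ih =>
    obtain ⟨gs', hlen, hval, hfan, hin, href⟩ :=
      ih (fun x hx => hs x (List.mem_append_left _ hx)) (fun x hx => h2 x (List.mem_append_left _ hx))
    obtain ⟨g', hev, hfan', hin', href'⟩ :=
      exists_wsNormGate g (hs g (by simp)) (h2 g (by simp))
    refine ⟨gs' ++ [g'], by simp [hlen], ?_, ?_, ?_, ?_⟩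
    · rw [gateValues_append_singleton, gateValues_append_singleton, hval, hev]
    · intro x hx
      rw [List.mem_append, List.mem_singleton] at hx
      rcases hx with hx | rfl
      exacts [hfan x hx, hfan']
    · intro x hx
      rw [List.mem_append, List.mem_singleton] at hx
      rcases hx with hx | rfl
      exacts [hin x hx, hin']
    · intro i x hx
      rcases lt_trichotomy i gs'.length with hi | rfl | hi
      · rw [List.getElem?_append_left hi] at hx
        obtain ⟨y, hy, hy'⟩ := href i x hx
        exact ⟨y, by rwa [List.getElem?_append_left (hlen ▸ hi)], hy'⟩
      · rw [List.getElem?_append_right le_rfl, Nat.sub_self, List.getElem?_cons_zero,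
          Option.some.injEq] at hx
        subst hx
        refine ⟨g, ?_, href'⟩
        rw [hlen, List.getElem?_append_right le_rfl, Nat.sub_self, List.getElem?_cons_zero]
      · exfalso
        have h1 : (gs' ++ [g'])[i]? = none := by
          rw [List.getElem?_eq_none_iff, List.length_append, List.length_singleton]; omega
        rw [h1] at hx
        exact absurd hx (by simp)

/-- **A well-formed fan-in-two skew circuit yields a well-formed fan-in-two WEAKLY SKEW circuit
of the same size computing the same polynomial** (BLMW 2011 §9.4: "skew circuits are weakly
skew"; in the gate model after the normalisation `prod [] ↦ prod [const 1]`,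
`prod [gate j] ↦ sum [(1, gate j)]`). [cite: BurgisserEtAl2011, §9.4 (skew circuits are weakly skew)] -/
theorem exists_isWeaklySkew_of_isSkew (P : ArithCircuit k σ) (hwf : P.WellFormed)
    (h2 : P.IsFanInTwo) (hs : P.IsSkew) :
    ∃ Q : ArithCircuit k σ, Q.WellFormed ∧ Q.IsFanInTwo ∧ Q.IsWeaklySkew ∧ Q.eval = P.eval ∧
      Q.size = P.size := by
  obtain ⟨gs', hlen, hval, hfan, hin, href⟩ := exists_wsNormGates P.gates hs h2
  refine ⟨⟨gs', P.output⟩, ⟨fun i g' hg' => ?_, ?_⟩, fun g hg => hfan g hg,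
    isWeaklySkew_of_hasInputFactor fun g hg => hin g hg, ?_, ?_⟩
  · obtain ⟨g, hg, hgg'⟩ := href i g' hg'
    exact hgg' i (hwf.1 i g hg)
  · show P.output.RefsBelow gs'.length
    rw [hlen]; exact hwf.2
  · show P.output.eval (gateValues gs') = P.output.eval (gateValues P.gates)
    rw [hval]
  · show gs'.length = P.gates.length
    exact hlen

/-- **Every polynomial is computed by some well-formed fan-in-two weakly skew circuit** — the
defining set of the (corrected) `wsComplexity` is never empty.
[cite: BurgisserEtAl2011, §9.1 (L_ws)] -/
theorem exists_wellFormed_isWeaklySkew_computes (f : MvPolynomial σ k) :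
    ∃ P : ArithCircuit k σ, P.WellFormed ∧ P.IsFanInTwo ∧ P.IsWeaklySkew ∧ P.Computes f := by
  obtain ⟨P, hwf, h2, hs, hc⟩ := exists_wellFormed_isSkew_computes f
  obtain ⟨Q, hq1, hq2, hq3, hq4, -⟩ := exists_isWeaklySkew_of_isSkew P hwf h2 hs
  exact ⟨Q, hq1, hq2, hq3, hq4.trans hc⟩

/-- **`L_ws(f)` is attained**: a well-formed fan-in-two weakly skew circuit of size exactly
`wsComplexity f` exists for every `f` (so the corrected `wsComplexity` never takes the `sInf ∅`
junk value). [cite: BurgisserEtAl2011, §9.1 (L_ws)] -/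
theorem wsComplexity_attained (f : MvPolynomial σ k) :
    ∃ P : ArithCircuit k σ, P.WellFormed ∧ P.IsFanInTwo ∧ P.IsWeaklySkew ∧ P.Computes f ∧
      P.size = wsComplexity f :=
  exists_size_eq_wsComplexity (exists_wellFormed_isWeaklySkew_computes f)

/-- **`L_ws(f) ≤ L_skew(f)`** (BLMW 2011 §9.4: skew circuits are weakly skew; corrected notions,
every commutative semiring). The converse up to a constant factor is conjunct (iii) of
`BLMW2011_sec9_detVPws` ([koka:08]), not proved here.
[cite: BurgisserEtAl2011, §9.4 (skew circuits are weakly skew)] -/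
theorem wsComplexity_le_skewComplexity (f : MvPolynomial σ k) :
    wsComplexity f ≤ skewComplexity f := by
  obtain ⟨P, hwf, h2, hs, hc, hsz⟩ := skewComplexity_attained f
  obtain ⟨Q, hq1, hq2, hq3, hq4, hq5⟩ := exists_isWeaklySkew_of_isSkew P hwf h2 hs
  rw [← hsz, ← hq5]
  exact wsComplexity_le_size (f := f) Q hq1 hq2 hq3 (hq4.trans hc)

end SkewToWs

end HI16Skew

/-- **`BLMW2011_sec9_detVPws` reduces to its conjunct (iii)** (for the CORRECTED notions, erratum
A14): conjunct (i) is `HI16Skew.isVPwsFamily_detPoly ℂ`; conjunct (ii) follows from (iii) by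
`HI16Skew.isPProjection_detPoly_of_skew_le_ws`. What remains of the fact is exactly
"weakly skew ⇒ skew with a linear size factor" ([koka:08], BLMW §9.4).
[cite: BurgisserEtAl2011, §9.1–§9.2, §9.4] -/
theorem BLMW2011_sec9_detVPws_of_skew_le_ws
    (h3 : ∃ c : ℕ, ∀ {σ : Type} [Fintype σ] (f : MvPolynomial σ ℂ),
      skewComplexity f ≤ c * wsComplexity f) :
    BLMW2011_sec9_detVPws := by
  obtain ⟨c, hc⟩ := h3
  exact ⟨HI16Skew.isVPwsFamily_detPoly ℂ,
    fun v f hf => HI16Skew.isPProjection_detPoly_of_skew_le_ws c hc v f hf, c, hc⟩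

/-! ## `VP_ws` families have p-bounded degree (hypothesis-free; BLMW 2011 §9.1) -/

section Degree

/-- **A `VP_ws` family (corrected notion) has polynomially bounded degree** — BLMW 2011 §9.1, the
sentence "the degree of the polynomial computed by a weakly-skew circuit is bounded by its size"
that justifies the absence of a degree clause in `VP_ws`; hypothesis-free form of
`isPBounded_totalDegree_of_isVPwsFamily` (`BLMW11WeaklySkewDegree.lean`), the weakly-skew circuits
being supplied by `HI16Skew.exists_wellFormed_isWeaklySkew_computes` (the corrected `L_ws` set is
never empty). [cite: BurgisserEtAl2011, §9.1 (VP_ws)] -/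
theorem IsVPwsFamily.isPBounded_totalDegree {k : Type u} [CommSemiring k] {σ : ℕ → Type v}
    {f : ∀ n, MvPolynomial (σ n) k} (hf : IsVPwsFamily f) :
    IsPBounded fun n => (f n).totalDegree :=
  isPBounded_totalDegree_of_isVPwsFamily hf fun n =>
    HI16Skew.exists_wellFormed_isWeaklySkew_computes (f n)

end Degree

end Literature.Computability.AlgebraicComplexity
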